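import Mathlib
import HarnessLib
import HarnessLib.Audit
import Summits.Langlands.Langlands.Theorems.RelativeFifteenSplit

/-!
# RelativeSevenSplit — lens-5 g36 (kit 5): the RELATIVE seven moduli door RSD (= g35's SMD relative to a subfield `F ⊆ K₀`;
# SMD ⟸ RSD) — on heptagonal-free fields whose `7`-growth is QUADRATIC-INHERITED a non-modular curve has `[ℚ(j):ℚ] ≤ 4`: off the
# `√5`-sector that is never in the residual range (EMPTY cell), on it only the quartic-`j` cell `[ℚ(j):ℚ] = 4 ∧ √5 ∈ ℚ(j)` survives;
# `Residual38` ⟸ BOX13 ∧ RSD ∧ `Residual39`, EXACT modulo the lineage's doors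

THESIS.  Residual of record `Residual38` (kit 4, `…Theorems.RelativeFifteenSplit.Residual38`) = `GenuineNonSqrtFiveSector36 ∧
GenuineBorelFiveCell36 ∧ H8Cell36 ∧ H12Cell36`, all on SEVEN-GROWTH fields.  Kit 4 made the level-`15` dial RELATIVE; this node does the same
at level `7`.  Dial: `SevenQuadInherited K₀ := HeptagonalFree K₀ ∧ ∃ F ⊆ K₀, [F:ℚ] ≤ 2 ∧ 21A1(K₀) ⊆ 21A1(F) ∧ 49A4(K₀) ⊆ 49A4(F)`.
Junction **RSD** `RelativeSevenDoor`: an integral `E / K₀` of shape `(b3 ∨ s3⁺) ∧ (b7 ∨ e7)` over a field with `RelSevenStable K₀ F` has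
`j(E)` in a subfield `L ⊆ K₀` with `[L:ℚ] ≤ 2·[F:ℚ]` — g35's printed case analysis with `ℚ ↦ F`: `b3 ∧ b7` — a non-cuspidal `K₀`-point of
`X₀(21) ≅ 21A1`, in `21A1(F)`, so `j ∈ F`; `s3⁺ ∧ b7` — a `K₀`-point `P` of `X(s3,b7)` over an `F`-rational point of `Y ≅ 21A1` (degree-`2`
map), so `[F(P):F] ≤ 2`, `j ∈ F(P)`; `e7` — an `F`-rational point of `X(e7) ≅ 49A4`, `j ∈ F` [Yoshikawa2022, proof of Lemma 3.2;
FreitasLeHungSiksek2015 §7, Prop. (large2) (c), Lemma (de7)]; SMD = RSD at `F = ⊥` (`sevenModuliDoor_of_relative`, PROVED).  KERNEL: with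
`[F:ℚ] ≤ 2`, `jDeg ≤ [L:ℚ] ≤ 4`; `InResidualRange` is `jDeg ≥ 5 ∨ (jDeg = 4 ∧ √5 ∈ ℚ⟮j⟯)` and `√5 ∈ ℚ⟮j⟯ ⊆ K₀ ⇒ √5 ∈ K₀`: OFF the
`√5`-sector the seven-inherited cell is EMPTY (`sevenInheritedNonSqrtFiveCell36_closed`, shapes from BOX13 (i),(iii)); ON it only the
QUARTIC-`j` CELL `SqrtFiveQuarticJCell36` survives (`jDeg = 4`, `√5 ∈ ℚ(j)`: QuarticModularity's object, stmt-Langlands-17832, OPEN; no door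
claimed), and only on fields with `4 ∣ [K₀:ℚ]` (`jDeg ∣ [K₀:ℚ]`) — on a seven-inherited field of degree `≢ 0 (mod 4)`, e.g. EVERY SEXTIC,
the whole residual range is modular modulo BOX13 ∧ RSD with NO hypothesis at `5` (`modular_of_sevenQuadInherited_of_not_four_dvd`).
ALSO (crit-1 row 557, R1, adopted): kit 4's `15`-dial widened from `[F:ℚ] ≤ 2` to `SmallBase F := [F:ℚ] ≤ 3 ∨ ([F:ℚ] ≤ 4 ∧ √5 ∉ F)`
(`FifteenInherited K₀` ⊇ `QuadInherited K₀`): `j ∈ F` is then never in the residual range (`not_inResidualRange_of_mem_smallBase`), so the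
fifteen-inherited Borel cells are EMPTY on both sectors from RFD — no new junction.  `Residual38` ⟸ BOX13 ∧ RFD ∧ RSD ∧ `Residual39`;
`Residual39` ⟸ C5D ∧ RFD ∧ `Residual38`; `Residual39 := GenuineNonSqrtFiveSector38 ∧ SqrtFiveQuarticJCell36 ∧ GenuineBorelFiveCell38 ∧
H8Cell38 ∧ H12Cell38`.  BY NAME up the lineage `hS : SevenModuliDoor` is REPLACED by `hRSD : RelativeSevenDoor`: same binder count.

WHY THIS LINE.  Census-1 I-g34.1 measured it (rung 0, sizes not theorems).  v4: of the 33 IN-BOX real cyclic sextics with `7 ∣ f ≤ 1250`,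
RES36 = 30 = 13 «relative-door candidates» (f = 133 ×3, 217, 364, 679 ×2, 973, 1064 ×3, 1141 ×2) + 5 with torsion inherited from `ℚ(√7)`
+ 6 genuine + 6 HEPT — «with a relative seven-stability door over the quadratic subfield the residual would be 12».  v5 (`√5`-sector, f = 5m
≤ 2000): 17 in-box sextics, of which NINE (f = 315, 455 ×2, 665 ×2, 1085, 1295 ×2, 1505) are hept-free with no relative `21A1`/`49A4`
growth and `ℚ`-torsion — seven-inherited candidates, closed ENTIRELY by the corollary (a sextic has no quartic subfield).  The box's own
clause B7 (`UnanchoredBox`) cannot do this: it needs `7 ∤ disc K₀` (void at conductor `7k`) and `K₀/F` Galois, solvable, ODD; RSD uses NO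
base change — `[F:ℚ] ≤ 2` enters only through the residual RANGE.  NEW COVERAGE: hept-free fields with quadratic-inherited `7`-growth that
are ramified at `7`, or have `[K₀:F]` even, or `K₀/F` non-Galois-solvable — on both `√5`-sectors.  Nearest tree prior art: g35
`MordellWeilSevenSplit` (SMD, `F = ℚ`), kit 4 `RelativeFifteenSplit` (the same move at `15`), TowerDoorSplit B7 — DELTA: relative
`7`-stability over a quadratic subfield with no base change, valid at `7 ∣ disc K₀`.

RANKED CRUXES.  `Residual39` (rank 2; RESIDUAL, WEAKER, EXACT modulo BOX13 ∧ C5D ∧ RFD ∧ RSD): the pieces on GENUINE-`7`-growth fields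
(`ℚ(ζ₇)⁺ ⊆ K₀`, or `21A1`/`49A4` acquire a point outside every subfield of degree `≤ 2`; census v4: 6 genuine + 6 HEPT in-box sextics)
and the quartic-`j` cell (degree `4 ∣ d` only).  `RelativeSevenDoor` (rank 3; PRINT junction, binder; generalises SMD).
KILL CRITERIA.  A `K₀`-point of `X(s3,b7)` over an `F`-rational point of `Y` generating more than a quadratic extension of `F` — impossible,
the map has degree `2` [FreitasLeHungSiksek2015 §7].  NOT DECOMPOSED YET.  The quartic-`j` cell (descent to `ℚ(j)` + QuarticModularity +
base change: IDEA-level); the HEPT sub-sector (no shape at `7`).  CHEAPEST FALSIFIER.  An exact certificate (2-descent / `Ш`-exactness) that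
`21A1(K) = 21A1(ℚ)`, `49A4(K) = 49A4(ℚ)` for the three conductor-`133` sextics of v4: then they carry no residual at all.
HONEST STATUS.  CONDITIONAL node: RSD is a PRINT junction (binder, credits nothing; no moduli interpretation of `X₀(21)`, `X(s3,b7)`, `X(e7)`
is in the tree), exactly as SMD which it implies; BOX13 = `Box2022_theorem1_3` (named fact).  The closed cells are EMPTY cells; nothing here
proves a curve modular.  Count-neutral NODE.
References: [Yoshikawa2022] S. Yoshikawa, arXiv 2022, Lemmas 3.1–3.2 and proofs; [FreitasLeHungSiksek2015] arXiv:1310.7088 §7;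
[Box2022] arXiv:2103.13975 Thm 1.3; [Thorne2019] arXiv:1505.04769 Lemma 3 (the relative moduli step); census-1 I-g34.1 v4/v5
(HOME/census/data/gen_v34/I-g34-1/I-g34-1.md, result.json `in_box_extension_v4`, `sqrt5_sector_v5`).
-/

set_option linter.dupNamespace false -- project-wide option; `Summit.Langlands.Langlands` is the mandated namespace

open scoped NumberField IntermediateField MatrixGroups
open NumberField Field Literature.NumberTheory.Automorphic
open Literature.NumberTheory.GaloisRepresentations
open Summit.Langlands.Langlands.Theorems.DepthIsolationSplit (UnanchoredBox IntegralModelTransferPointwise)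
open Summit.Langlands.Langlands.Theorems.JDegreeFilterSplit (jInv jDeg InResidualRange RatBaseChangeModularity
  SmallFieldBaseChange)
open Summit.Langlands.Langlands.Theorems.DyadicDoorSplit (AllenLocus AllenDyadicCorollary)
open Summit.Langlands.Langlands.Theorems.OddPrimeDoorSplit (OffDoors SkinnerWilesDihedralDoor PanZhangSupersingularDoor)
open Summit.Langlands.Langlands.Theorems.RealCyclotomicDoorSplit (BorelAt BorelOrSplitCartanThree BorelOrE7Seven BoxShape
  boxShape_of_box13)
open Summit.Langlands.Langlands.Theorems.ReductionSignatureSplit (OffSignatureDoors NearlyOrdinaryDihedralDoorThree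
  SplitOrdinaryDihedralDoor MixedSignatureDoor)
open Summit.Langlands.Langlands.Theorems.NearlyOrdinaryDistinguishedSplit (OnNODDoor NearlyOrdinaryDistinguishedDoor)
open Summit.Langlands.Langlands.Theorems.MordellWeilFifteenSplit (FifteenStable Growth FifteenModuliDoor)
open Summit.Langlands.Langlands.Theorems.MordellWeilSevenSplit (E21 E49 SevenStable HeptagonalFree SevenGrowth SevenModuliDoor
  Residual36 not_inResidualRange_of_jDeg_le_two)
open Summit.Langlands.Langlands.Theorems.CartanFiveSplit (H8At H12At CartanFiveDoor H8Cell36 H12Cell36 Residual37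
  cartanFiveDoor_of_FLS2015_theorem3)
open Summit.Langlands.Langlands.Theorems.RelativeFifteenSplit (PointsIn RelFifteenStable QuadInherited RelativeFifteenDoor
  GenuineNonSqrtFiveSector36 GenuineBorelFiveCell36 Residual38 jDeg_le_finrank_of_mem not_inResidualRange_of_quadInherited
  residual37_of_pieces38 fifteenModuliDoor_of_relative)

namespace Summit.Langlands.Langlands.Theorems.RelativeSevenSplit

/-! ## §1 The dial: RELATIVE Mordell–Weil stability of `21A1 ≅ X₀(21)`, `49A4 ≅ X(e7)` with respect to a subfield `F ⊆ K₀` -/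

/-- RELATIVE SEVEN-STABILITY of `K₀` over the subfield `F`: no Mordell–Weil growth of `21A1` and `49A4` from `F` to `K₀` (kit 4's
`PointsIn`; at `F = ⊥` this is g35's `SevenStable K₀`, `relSevenStable_bot_iff`). -/
def RelSevenStable (K₀ : Type) [Field K₀] [NumberField K₀] (F : IntermediateField ℚ K₀) : Prop :=
  PointsIn E21 K₀ F ∧ PointsIn E49 K₀ F

/-- QUADRATIC-INHERITED `7`-growth: `ℚ(ζ₇)⁺ ⊄ K₀` and some subfield `F ⊆ K₀` of degree `≤ 2` carries all `K₀`-points of `21A1` and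
`49A4` (includes g35's closed case `HeptagonalFree ∧ SevenStable`, `F = ⊥`). -/
def SevenQuadInherited (K₀ : Type) [Field K₀] [NumberField K₀] : Prop :=
  HeptagonalFree K₀ ∧ ∃ F : IntermediateField ℚ K₀, Module.finrank ℚ F ≤ 2 ∧ RelSevenStable K₀ F

/-- At `F = ⊥` relative seven-stability is g35's absolute seven-stability. -/
theorem relSevenStable_bot_iff (K₀ : Type) [Field K₀] [NumberField K₀] : RelSevenStable K₀ ⊥ ↔ SevenStable K₀ := by
  simp only [RelSevenStable, SevenStable, PointsIn, Thorne2019.PointsRational, IntermediateField.mem_bot]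

/-- g35's closed case is quadratic-inherited (`F = ⊥`, `[⊥:ℚ] = 1`). -/
theorem sevenQuadInherited_of_stable {K₀ : Type} [Field K₀] [NumberField K₀] (h7 : HeptagonalFree K₀) (hst : SevenStable K₀) :
    SevenQuadInherited K₀ :=
  ⟨h7, ⊥, by rw [IntermediateField.finrank_bot]; norm_num, (relSevenStable_bot_iff K₀).mpr hst⟩

/-! ## §1b The level-`15` dial of kit 4 widened to the whole non-residual base range (crit-1 row 557, R1) -/

/-- A subfield `F ⊆ K₀` in the NON-residual base range of g27's `j`-degree dial: `[F:ℚ] ≤ 3`, or `[F:ℚ] ≤ 4` with `√5 ∉ F`. -/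
def SmallBase {K₀ : Type} [Field K₀] [NumberField K₀] (F : IntermediateField ℚ K₀) : Prop :=
  Module.finrank ℚ F ≤ 3 ∨ (Module.finrank ℚ F ≤ 4 ∧ ¬ IsSquare (5 : F))

/-- FIFTEEN-INHERITED growth: some `F ⊆ K₀` in the small base range carries all `K₀`-points of `E₁` and `E₂` (⊇ kit 4's
`QuadInherited K₀`, `fifteenInherited_of_quadInherited`). -/
def FifteenInherited (K₀ : Type) [Field K₀] [NumberField K₀] : Prop :=
  ∃ F : IntermediateField ℚ K₀, SmallBase F ∧ RelFifteenStable K₀ F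

/-- Quadratic-inherited is fifteen-inherited. -/
theorem fifteenInherited_of_quadInherited {K₀ : Type} [Field K₀] [NumberField K₀] (h : QuadInherited K₀) :
    FifteenInherited K₀ := by
  obtain ⟨F, hF2, hst⟩ := h
  exact ⟨F, Or.inl (by omega), hst⟩

/-- … so genuine-beyond-small-base implies genuine-beyond-quadratic. -/
theorem not_quadInherited_of_not_fifteenInherited {K₀ : Type} [Field K₀] [NumberField K₀] (h : ¬ FifteenInherited K₀) :
    ¬ QuadInherited K₀ :=
  fun hq => h (fifteenInherited_of_quadInherited hq)

/-- KERNEL (R1): `j ∈ F` with `F` in the small base range is never in the residual range — `jDeg ≤ [F:ℚ] ≤ 3`, or `jDeg ≤ 4` and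
`√5 ∈ ℚ⟮j⟯ ≤ F` would put `√5` in `F`. -/
theorem not_inResidualRange_of_mem_smallBase {K₀ : Type} [Field K₀] [NumberField K₀] (E : WeierstrassCurve (𝓞 K₀))
    (F : IntermediateField ℚ K₀) (hF : SmallBase F) (hj : jInv K₀ E ∈ F) : ¬ InResidualRange K₀ E := by
  have hle : ℚ⟮jInv K₀ E⟯ ≤ F := IntermediateField.adjoin_simple_le_iff.mpr hj
  have hdeg : jDeg K₀ E ≤ Module.finrank ℚ F := jDeg_le_finrank_of_mem E F hj
  rcases hF with h3 | ⟨h4, h5⟩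
  · rintro (h | ⟨h, -⟩) <;> omega
  · rintro (h | ⟨-, hsq⟩)
    · omega
    · exact h5 (by simpa only [map_ofNat] using hsq.map (IntermediateField.inclusion hle))

/-- THE WIDENED `15`-DOOR MECHANISM: over a fifteen-inherited `K₀`, a curve of shape `(b3 ∨ s3⁺, b5)` is NOT in the residual range
(RFD, kit 4's junction; no new print). -/
theorem not_inResidualRange_of_fifteenInherited (hF : RelativeFifteenDoor) {K₀ : Type} [Field K₀] [NumberField K₀]
    (hq : FifteenInherited K₀) {E : WeierstrassCurve (𝓞 K₀)} (hΔ : E.Δ ≠ 0) (h3 : BorelOrSplitCartanThree K₀ E)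
    (hb5 : BorelAt K₀ E 5) : ¬ InResidualRange K₀ E := by
  obtain ⟨F, hFs, hst⟩ := hq
  exact not_inResidualRange_of_mem_smallBase E F hFs (hF K₀ F E hΔ h3 hb5 hst)

/-! ## §2 The ONE new print junction RSD, and SMD ⟸ RSD -/

/-- **RSD — RELATIVE SEVEN MODULI DOOR** (PRINT junction; binder, credits nothing).  For `E / 𝓞 K₀` with `Δ ≠ 0`, of `B(3)`-or-`C_s⁺(3)`
shape at `3` and `B(7)`-or-`G(e7)` shape at `7` (g31 decls = clauses (i), (iii) of `Box2022_theorem1_3` verbatim), over a field with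
`21A1(K₀) ⊆ 21A1(F)` and `49A4(K₀) ⊆ 49A4(F)`: `j(E)` lies in a subfield `L ⊆ K₀` with `[L:ℚ] ≤ 2·[F:ℚ]`.  Printed case analysis (g35's SMD
docstring with `ℚ ↦ F`): `b3 ∧ b7` — a non-cuspidal `K₀`-point of `X₀(21) ≅ 21A1`, in `21A1(F)`, so `j ∈ F` (`L = F`); `s3⁺ ∧ b7` — a `K₀`-point
`P` of `X(s3,b7)` whose image in `Y ≅ 21A1` is `F`-rational, so `[F(P):F] ≤ 2` and `j(E) = j(P) ∈ L = F(P)`; `e7` — a `K₀`-point of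
`X(e7) ≅ 49A4`, `F`-rational, so `j ∈ F`.  g35's SMD is the case `F = ⊥` (`sevenModuliDoor_of_relative`).  NOT in the tree.
[ref: Yoshikawa2022, proof of Lemma 3.2] [ref: FreitasLeHungSiksek2015, §7; Prop. (large2) (c); Lemma (de7)] [ref: Thorne2019, Lemma 3] -/
def RelativeSevenDoor : Prop :=
  ∀ (K₀ : Type) [Field K₀] [NumberField K₀] (F : IntermediateField ℚ K₀) (E : WeierstrassCurve (𝓞 K₀)), E.Δ ≠ 0 →
    BorelOrSplitCartanThree K₀ E → BorelOrE7Seven K₀ E → RelSevenStable K₀ F →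
      ∃ L : IntermediateField ℚ K₀, Module.finrank ℚ L ≤ 2 * Module.finrank ℚ F ∧ jInv K₀ E ∈ L

/-- **SMD ⟸ RSD** (PROVED; `F = ⊥`, `[⊥:ℚ] = 1`, `jDeg ≤ [L:ℚ] ≤ 2`): g35's binder is the absolute case of this node's. -/
theorem sevenModuliDoor_of_relative (h : RelativeSevenDoor) : SevenModuliDoor := by
  intro K₀ _ _ E hΔ h3 h7 hst
  obtain ⟨L, hL, hj⟩ := h K₀ ⊥ E hΔ h3 h7 ((relSevenStable_bot_iff K₀).mpr hst)
  rw [IntermediateField.finrank_bot] at hL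
  exact (jDeg_le_finrank_of_mem E L hj).trans (by omega)

/-- KERNEL: over a quadratic-inherited-seven field a curve of shape `(b3 ∨ s3⁺) ∧ (b7 ∨ e7)` has `[ℚ(j):ℚ] ≤ 4`. -/
theorem jDeg_le_four_of_sevenQuadInherited (hR : RelativeSevenDoor) {K₀ : Type} [Field K₀] [NumberField K₀]
    (hq : SevenQuadInherited K₀) {E : WeierstrassCurve (𝓞 K₀)} (hΔ : E.Δ ≠ 0) (h3 : BorelOrSplitCartanThree K₀ E)
    (h7 : BorelOrE7Seven K₀ E) : jDeg K₀ E ≤ 4 := by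
  obtain ⟨-, F, hF2, hst⟩ := hq
  obtain ⟨L, hL, hj⟩ := hR K₀ F E hΔ h3 h7 hst
  exact (jDeg_le_finrank_of_mem E L hj).trans (by omega)

/-- KERNEL: `√5 ∈ ℚ⟮j⟯ ⊆ K₀ ⇒ √5 ∈ K₀`. -/
theorem isSquare_five_of_adjoin {K₀ : Type} [Field K₀] [NumberField K₀] (E : WeierstrassCurve (𝓞 K₀))
    (h : IsSquare (5 : ℚ⟮jInv K₀ E⟯)) : IsSquare (5 : K₀) := by
  simpa only [map_ofNat] using h.map (ℚ⟮jInv K₀ E⟯).val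

/-- KERNEL: `[ℚ(j):ℚ] ≤ 4` over a field WITHOUT `√5` is never in the residual range (`≥ 5`, or `= 4` with `√5 ∈ ℚ(j)`). -/
theorem not_inResidualRange_of_jDeg_le_four {K₀ : Type} [Field K₀] [NumberField K₀] {E : WeierstrassCurve (𝓞 K₀)}
    (h4 : jDeg K₀ E ≤ 4) (h5 : ¬ IsSquare (5 : K₀)) : ¬ InResidualRange K₀ E := by
  rintro (h | ⟨-, hsq⟩)
  · omega
  · exact h5 (isSquare_five_of_adjoin E hsq)

/-- KERNEL: `[ℚ(j):ℚ] ≤ 4` in the residual range means `[ℚ(j):ℚ] = 4` (and `√5 ∈ ℚ(j)`). -/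
theorem jDeg_eq_four_of_inResidualRange {K₀ : Type} [Field K₀] [NumberField K₀] {E : WeierstrassCurve (𝓞 K₀)}
    (h4 : jDeg K₀ E ≤ 4) (hr : InResidualRange K₀ E) : jDeg K₀ E = 4 := by
  rcases hr with h | ⟨h, -⟩ <;> omega

/-- KERNEL: `[ℚ(j):ℚ] = 4` forces `4 ∣ [K₀:ℚ]` (`jDeg ∣ [K₀:ℚ]`, g26). -/
theorem four_dvd_finrank_of_jDeg_eq_four {K₀ : Type} [Field K₀] [NumberField K₀] {E : WeierstrassCurve (𝓞 K₀)}
    (h4 : jDeg K₀ E = 4) : 4 ∣ Module.finrank ℚ K₀ :=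
  h4 ▸ Summit.Langlands.Langlands.Theorems.ModuliFieldDescentSplit.jDeg_dvd_finrank K₀ E

/-- THE DOOR MECHANISM one storey up: over a totally real quadratic-inherited-seven `K₀`, a NON-modular `E` has `[ℚ(j):ℚ] ≤ 4` —
BOX13 gives the shapes at `3` and `7` (no hypothesis at `5`), RSD the bound. -/
theorem jDeg_le_four_of_not_modular (hB : Box2022_theorem1_3) (hR : RelativeSevenDoor) (K₀ : Type) [Field K₀] [NumberField K₀]
    [IsTotallyReal K₀] (hq : SevenQuadInherited K₀) (E : WeierstrassCurve (𝓞 K₀)) (hΔ : E.Δ ≠ 0)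
    (hne : ¬ IsModularEllipticCurve K₀ E) : jDeg K₀ E ≤ 4 := by
  have hshape : BoxShape K₀ E :=
    boxShape_of_box13 hB K₀ E hΔ (not_isAutomorphicOfWeightZero_of_not_isModularEllipticCurve hΔ hne)
  exact jDeg_le_four_of_sevenQuadInherited hR hq hΔ hshape.1 (hshape.2.2 hq.1)

/-! ## §3 The pieces of `Residual38` by quadratic inheritance at `7` -/

/-- SEVEN-INHERITED CELL off the `√5`-sector (CLOSED — empty — from BOX13 ∧ RSD): RES36 on `√5 ∉ K₀`, quadratic-inherited `7`-growth. -/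
def SevenInheritedNonSqrtFiveCell36 : Prop :=
  ∀ (K₀ : Type) [Field K₀] [NumberField K₀], UnanchoredBox K₀ → Growth K₀ → SevenGrowth K₀ → ¬ IsSquare (5 : K₀) →
    SevenQuadInherited K₀ →
    ∀ E : WeierstrassCurve (𝓞 K₀), E.Δ ≠ 0 → InResidualRange K₀ E → ¬ AllenLocus K₀ E → OffDoors K₀ E →
      OffSignatureDoors K₀ E → ¬ OnNODDoor K₀ E → IsModularEllipticCurve K₀ E

/-- FIFTEEN-INHERITED CELL off the `√5`-sector (CLOSED — empty — from BOX13 ∧ RFD; kit 4's quadratic cell widened per R1). -/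
def FifteenInheritedNonSqrtFiveCell36 : Prop :=
  ∀ (K₀ : Type) [Field K₀] [NumberField K₀], UnanchoredBox K₀ → Growth K₀ → SevenGrowth K₀ → ¬ IsSquare (5 : K₀) →
    FifteenInherited K₀ →
    ∀ E : WeierstrassCurve (𝓞 K₀), E.Δ ≠ 0 → InResidualRange K₀ E → ¬ AllenLocus K₀ E → OffDoors K₀ E →
      OffSignatureDoors K₀ E → ¬ OnNODDoor K₀ E → IsModularEllipticCurve K₀ E

/-- FIFTEEN-INHERITED BOREL-`5` CELL of the `√5`-sector (CLOSED — empty — from RFD alone). -/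
def FifteenInheritedBorelFiveCell36 : Prop :=
  ∀ (K₀ : Type) [Field K₀] [NumberField K₀], UnanchoredBox K₀ → Growth K₀ → SevenGrowth K₀ → IsSquare (5 : K₀) →
    FifteenInherited K₀ →
    ∀ E : WeierstrassCurve (𝓞 K₀), E.Δ ≠ 0 → InResidualRange K₀ E → ¬ AllenLocus K₀ E → OffDoors K₀ E →
      OffSignatureDoors K₀ E → ¬ OnNODDoor K₀ E → BorelOrSplitCartanThree K₀ E → BorelAt K₀ E 5 →
        IsModularEllipticCurve K₀ E

/-- GENUINE sector off `√5` (RESIDUAL): kit 4's `GenuineNonSqrtFiveSector36` on fields whose `15`-growth is beyond the small base range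
AND whose `7`-growth is GENUINE. -/
def GenuineNonSqrtFiveSector38 : Prop :=
  ∀ (K₀ : Type) [Field K₀] [NumberField K₀], UnanchoredBox K₀ → Growth K₀ → SevenGrowth K₀ → ¬ IsSquare (5 : K₀) →
    ¬ FifteenInherited K₀ → ¬ SevenQuadInherited K₀ →
    ∀ E : WeierstrassCurve (𝓞 K₀), E.Δ ≠ 0 → InResidualRange K₀ E → ¬ AllenLocus K₀ E → OffDoors K₀ E →
      OffSignatureDoors K₀ E → ¬ OnNODDoor K₀ E → IsModularEllipticCurve K₀ E

/-- **THE QUARTIC-`j` CELL of the `√5`-sector** (RESIDUAL; shape-free): RES36 on `√5 ∈ K₀` OF DEGREE `4 ∣ [K₀:ℚ]`,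
quadratic-inherited `7`-growth, and `[ℚ(j):ℚ] = 4` — with `InResidualRange` this says `ℚ(j)` is a QUARTIC subfield containing `√5` (the
object of `QuarticModularity`, stmt-Langlands-17832, OPEN; `4 ∣ [K₀:ℚ]` is forced by `jDeg ∣ [K₀:ℚ]`, so e.g. NO sextic field carries
this cell).  No door claimed. -/
def SqrtFiveQuarticJCell36 : Prop :=
  ∀ (K₀ : Type) [Field K₀] [NumberField K₀], UnanchoredBox K₀ → Growth K₀ → SevenGrowth K₀ → IsSquare (5 : K₀) →
    4 ∣ Module.finrank ℚ K₀ → SevenQuadInherited K₀ →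
    ∀ E : WeierstrassCurve (𝓞 K₀), E.Δ ≠ 0 → InResidualRange K₀ E → ¬ AllenLocus K₀ E → OffDoors K₀ E →
      OffSignatureDoors K₀ E → ¬ OnNODDoor K₀ E → jDeg K₀ E = 4 → IsModularEllipticCurve K₀ E

/-- GENUINE Borel-`5` cell of the `√5`-sector (RESIDUAL): kit 4's `GenuineBorelFiveCell36` on fields with `15`-growth beyond the
small base range and genuine `7`-growth. -/
def GenuineBorelFiveCell38 : Prop :=
  ∀ (K₀ : Type) [Field K₀] [NumberField K₀], UnanchoredBox K₀ → Growth K₀ → SevenGrowth K₀ → IsSquare (5 : K₀) →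
    ¬ FifteenInherited K₀ → ¬ SevenQuadInherited K₀ →
    ∀ E : WeierstrassCurve (𝓞 K₀), E.Δ ≠ 0 → InResidualRange K₀ E → ¬ AllenLocus K₀ E → OffDoors K₀ E →
      OffSignatureDoors K₀ E → ¬ OnNODDoor K₀ E → BorelOrSplitCartanThree K₀ E → BorelAt K₀ E 5 →
        IsModularEllipticCurve K₀ E

/-- `H8` Cartan cell (RESIDUAL): g36's `H8Cell36` on genuine-`7`-growth fields. -/
def H8Cell38 : Prop :=
  ∀ (K₀ : Type) [Field K₀] [NumberField K₀], UnanchoredBox K₀ → Growth K₀ → SevenGrowth K₀ → IsSquare (5 : K₀) →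
    ¬ SevenQuadInherited K₀ →
    ∀ E : WeierstrassCurve (𝓞 K₀), E.Δ ≠ 0 → InResidualRange K₀ E → ¬ AllenLocus K₀ E → OffDoors K₀ E →
      OffSignatureDoors K₀ E → ¬ OnNODDoor K₀ E → BorelOrSplitCartanThree K₀ E → H8At K₀ E →
        IsModularEllipticCurve K₀ E

/-- `H12` Cartan cell (RESIDUAL): g36's `H12Cell36` on genuine-`7`-growth fields. -/
def H12Cell38 : Prop :=
  ∀ (K₀ : Type) [Field K₀] [NumberField K₀], UnanchoredBox K₀ → Growth K₀ → SevenGrowth K₀ → IsSquare (5 : K₀) →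
    ¬ SevenQuadInherited K₀ →
    ∀ E : WeierstrassCurve (𝓞 K₀), E.Δ ≠ 0 → InResidualRange K₀ E → ¬ AllenLocus K₀ E → OffDoors K₀ E →
      OffSignatureDoors K₀ E → ¬ OnNODDoor K₀ E → BorelOrSplitCartanThree K₀ E → H12At K₀ E →
        IsModularEllipticCurve K₀ E

/-- **Residual39 — THE DECLARED RESIDUAL** (WEAKER than `Residual38` modulo C5D ∧ RFD; gives it back modulo BOX13 ∧ RFD ∧ RSD). -/
def Residual39 : Prop :=
  GenuineNonSqrtFiveSector38 ∧ SqrtFiveQuarticJCell36 ∧ GenuineBorelFiveCell38 ∧ H8Cell38 ∧ H12Cell38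

/-! ## §4 Kernel: the seven-inherited cell off `√5` is empty; `Residual38` from the pieces; `Residual39` from `Residual38` -/

/-- **The seven-inherited cell OFF `√5` is CLOSED** (empty): `jDeg ≤ 4` by BOX13 ∧ RSD, never in the residual range without `√5`. -/
theorem sevenInheritedNonSqrtFiveCell36_closed (hB : Box2022_theorem1_3) (hR : RelativeSevenDoor) :
    SevenInheritedNonSqrtFiveCell36 := by
  intro K₀ _ _ hU _ _ h5 hq E hΔ hr _ _ _ _
  haveI : IsTotallyReal K₀ := hU.1
  by_contra hne
  exact not_inResidualRange_of_jDeg_le_four (jDeg_le_four_of_not_modular hB hR K₀ hq E hΔ hne) h5 hr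

/-- **The fifteen-inherited cell OFF `√5` is CLOSED** (empty; BOX13 shapes ∧ RFD). -/
theorem fifteenInheritedNonSqrtFiveCell36_closed (hB : Box2022_theorem1_3) (hF : RelativeFifteenDoor) :
    FifteenInheritedNonSqrtFiveCell36 := by
  intro K₀ _ _ hU _ _ h5 hq E hΔ hr _ _ _ _
  haveI : IsTotallyReal K₀ := hU.1
  by_contra hne
  have hshape : BoxShape K₀ E :=
    boxShape_of_box13 hB K₀ E hΔ (not_isAutomorphicOfWeightZero_of_not_isModularEllipticCurve hΔ hne)
  exact not_inResidualRange_of_fifteenInherited hF hq hΔ hshape.1 (hshape.2.1 h5) hr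

/-- **The fifteen-inherited Borel-`5` cell ON `√5` is CLOSED** (empty; RFD alone). -/
theorem fifteenInheritedBorelFiveCell36_closed (hF : RelativeFifteenDoor) : FifteenInheritedBorelFiveCell36 := by
  intro K₀ _ _ _ _ _ _ hq E hΔ hr _ _ _ _ h3 hb5
  exact absurd hr (not_inResidualRange_of_fifteenInherited hF hq hΔ h3 hb5)

/-- **`Residual38` from the pieces**: BOX13 ∧ RFD ∧ RSD ∧ `Residual39` ⇒ `Residual38`.  On the `√5`-pieces a non-modular curve over a
seven-inherited field has `jDeg ≤ 4` (BOX13 (i),(iii) ∧ RSD), hence `jDeg = 4` in the residual range: the quartic-`j` cell. -/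
theorem residual38_of_pieces39 (hB : Box2022_theorem1_3) (hF : RelativeFifteenDoor) (hR : RelativeSevenDoor) (h : Residual39) :
    Residual38 := by
  obtain ⟨hGNS, hQ, hGB5, h8, h12⟩ := h
  refine ⟨?_, ?_, ?_, ?_⟩
  · intro K₀ _ _ hU hG hS h5 _ E hΔ hr hA hO hSig hN
    by_cases hq15 : FifteenInherited K₀
    · exact fifteenInheritedNonSqrtFiveCell36_closed hB hF K₀ hU hG hS h5 hq15 E hΔ hr hA hO hSig hN
    by_cases hq : SevenQuadInherited K₀
    · exact sevenInheritedNonSqrtFiveCell36_closed hB hR K₀ hU hG hS h5 hq E hΔ hr hA hO hSig hN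
    · exact hGNS K₀ hU hG hS h5 hq15 hq E hΔ hr hA hO hSig hN
  · intro K₀ _ _ hU hG hS h5 _ E hΔ hr hA hO hSig hN h3 hb
    by_cases hq15 : FifteenInherited K₀
    · exact fifteenInheritedBorelFiveCell36_closed hF K₀ hU hG hS h5 hq15 E hΔ hr hA hO hSig hN h3 hb
    by_cases hq : SevenQuadInherited K₀
    · haveI : IsTotallyReal K₀ := hU.1
      by_contra hne
      have h4 := jDeg_eq_four_of_inResidualRange (jDeg_le_four_of_not_modular hB hR K₀ hq E hΔ hne) hr
      exact hne (hQ K₀ hU hG hS h5 (four_dvd_finrank_of_jDeg_eq_four h4) hq E hΔ hr hA hO hSig hN h4)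
    · exact hGB5 K₀ hU hG hS h5 hq15 hq E hΔ hr hA hO hSig hN h3 hb
  · intro K₀ _ _ hU hG hS h5 E hΔ hr hA hO hSig hN h3 h8At
    by_cases hq : SevenQuadInherited K₀
    · haveI : IsTotallyReal K₀ := hU.1
      by_contra hne
      have h4 := jDeg_eq_four_of_inResidualRange (jDeg_le_four_of_not_modular hB hR K₀ hq E hΔ hne) hr
      exact hne (hQ K₀ hU hG hS h5 (four_dvd_finrank_of_jDeg_eq_four h4) hq E hΔ hr hA hO hSig hN h4)
    · exact h8 K₀ hU hG hS h5 hq E hΔ hr hA hO hSig hN h3 h8At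
  · intro K₀ _ _ hU hG hS h5 E hΔ hr hA hO hSig hN h3 h12At
    by_cases hq : SevenQuadInherited K₀
    · haveI : IsTotallyReal K₀ := hU.1
      by_contra hne
      have h4 := jDeg_eq_four_of_inResidualRange (jDeg_le_four_of_not_modular hB hR K₀ hq E hΔ hne) hr
      exact hne (hQ K₀ hU hG hS h5 (four_dvd_finrank_of_jDeg_eq_four h4) hq E hΔ hr hA hO hSig hN h4)
    · exact h12 K₀ hU hG hS h5 hq E hΔ hr hA hO hSig hN h3 h12At

/-- **`Residual39` from `Residual38`** (modulo C5D ∧ RFD, which carve the shape-free quartic-`j` cell out of the three `√5`-pieces;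
the four genuine pieces are plain restrictions). -/
theorem residual39_of_residual38 (hD : CartanFiveDoor) (hF : RelativeFifteenDoor) (h : Residual38) : Residual39 := by
  obtain ⟨hGNS, hGB5, h8, h12⟩ := h
  refine ⟨fun K₀ _ _ hU hG hS h5 hq15 _ E hΔ hr hA hO hSig hN =>
      hGNS K₀ hU hG hS h5 (not_quadInherited_of_not_fifteenInherited hq15) E hΔ hr hA hO hSig hN, ?_,
    fun K₀ _ _ hU hG hS h5 hq15 _ E hΔ hr hA hO hSig hN h3 hb =>
      hGB5 K₀ hU hG hS h5 (not_quadInherited_of_not_fifteenInherited hq15) E hΔ hr hA hO hSig hN h3 hb,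
    fun K₀ _ _ hU hG hS h5 _ E hΔ hr hA hO hSig hN h3 h8At => h8 K₀ hU hG hS h5 E hΔ hr hA hO hSig hN h3 h8At,
    fun K₀ _ _ hU hG hS h5 _ E hΔ hr hA hO hSig hN h3 h12At => h12 K₀ hU hG hS h5 E hΔ hr hA hO hSig hN h3 h12At⟩
  intro K₀ _ _ hU hG hS h5 _ _ E hΔ hr hA hO hSig hN h4
  by_contra hne
  obtain ⟨h3, hb | h8At | h12At⟩ := hD K₀ hU.1 h5 E hΔ hne
  · by_cases hq15 : QuadInherited K₀
    · exact not_inResidualRange_of_quadInherited hF hq15 hΔ h3 hb hr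
    · exact hne (hGB5 K₀ hU hG hS h5 hq15 E hΔ hr hA hO hSig hN h3 hb)
  · exact hne (h8 K₀ hU hG hS h5 E hΔ hr hA hO hSig hN h3 h8At)
  · exact hne (h12 K₀ hU hG hS h5 E hΔ hr hA hO hSig hN h3 h12At)

/-- **EXACTNESS**: modulo the lineage's doors BOX13 ∧ C5D ∧ RFD ∧ RSD, `Residual38 ↔ Residual39`. -/
theorem residual38_iff_residual39 (hB : Box2022_theorem1_3) (hD : CartanFiveDoor) (hF : RelativeFifteenDoor)
    (hR : RelativeSevenDoor) : Residual38 ↔ Residual39 :=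
  ⟨residual39_of_residual38 hD hF, residual38_of_pieces39 hB hF hR⟩

/-- Two storeys: `Residual37` ⟸ BOX13 ∧ RFD ∧ RSD ∧ `Residual39`. -/
theorem residual37_of_pieces39 (hB : Box2022_theorem1_3) (hF : RelativeFifteenDoor) (hR : RelativeSevenDoor)
    (h : Residual39) : Residual37 :=
  residual37_of_pieces38 hB hF (residual38_of_pieces39 hB hF hR h)

/-! ## §5 BY NAME up the lineage: binder `SevenModuliDoor` REPLACED by `RelativeSevenDoor`, residual `Residual39` -/

/-- **REST (stmt-Langlands-26998) BY NAME**: kit 4's `RelativeFifteenSplit.closes_byName` with `hS : SevenModuliDoor` replaced by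
`hRSD : RelativeSevenDoor` (SMD derived in-kernel) and `hR : Residual39`; same number of binders as g35 / g36.  CONDITIONAL display via
`closure.modulo`; credits nothing. -/
theorem closes_byName (hDBC : RatBaseChangeModularity) (hNSBC : SmallFieldBaseChange)
    (hFLS : FLS2015_theorem1) (hDNS : DNS2020_theorem4) (hBox : Box2022_theorem1_1)
    (hADC : AllenDyadicCorollary) (h34 : FLS2015_theorems3_4) (hSW : SkinnerWilesDihedralDoor)
    (hPZ : PanZhangSupersingularDoor) (hNO3 : NearlyOrdinaryDihedralDoorThree) (hNOS : SplitOrdinaryDihedralDoor)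
    (hMIX : MixedSignatureDoor) (hNOD : NearlyOrdinaryDistinguishedDoor) (hB : Box2022_theorem1_3)
    (hRFD : RelativeFifteenDoor) (hRSD : RelativeSevenDoor) (hR : Residual39)
    (hIMT : IntegralModelTransferPointwise)
    (hTr : Summit.Langlands.Langlands.Theses.EllipticDegreeLadder.EllipticTransportAnyBase)
    (hW : Summit.Langlands.Langlands.Theses.EllipticDegreeLadder.SatakeAvatarExistence)
    (h1 : Summit.Langlands.Langlands.Theses.EllipticDegreeLadder.RankOneAutomorphy) :
    Summit.Langlands.Langlands.Theses.TowerDoorSplit.UnanchoredHighDegreeWitnessAutomorphy :=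
  Summit.Langlands.Langlands.Theorems.RelativeFifteenSplit.closes_byName hDBC hNSBC hFLS hDNS hBox hADC h34 hSW hPZ hNO3 hNOS
    hMIX hNOD hB hRFD (sevenModuliDoor_of_relative hRSD) (residual38_of_pieces39 hB hRFD hRSD hR) hIMT hTr hW h1

/-! ## §6 One storey up: the field-level corollary -/

/-- **COROLLARY (the census reading): over a totally real `K₀` with `4 ∤ [K₀:ℚ]` (e.g. every SEXTIC field) whose `7`-growth is
quadratic-inherited (`ℚ(ζ₇)⁺ ⊄ K₀`), EVERY curve in the residual range is modular — modulo BOX13 ∧ RSD only, with NO hypothesis at `5`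
and on BOTH `√5`-sectors: `jDeg ≤ 4` off range, `jDeg = 4` impossible as `jDeg ∣ [K₀:ℚ]`.** -/
theorem modular_of_sevenQuadInherited_of_not_four_dvd (hB : Box2022_theorem1_3) (hR : RelativeSevenDoor) (K₀ : Type) [Field K₀]
    [NumberField K₀] [IsTotallyReal K₀] (hd : ¬ 4 ∣ Module.finrank ℚ K₀) (hq : SevenQuadInherited K₀) (E : WeierstrassCurve (𝓞 K₀))
    (hΔ : E.Δ ≠ 0) (hr : InResidualRange K₀ E) : IsModularEllipticCurve K₀ E := by
  by_contra hne
  exact hd (four_dvd_finrank_of_jDeg_eq_four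
    (jDeg_eq_four_of_inResidualRange (jDeg_le_four_of_not_modular hB hR K₀ hq E hΔ hne) hr))

end Summit.Langlands.Langlands.Theorems.RelativeSevenSplit
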